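import Summits.ValiantsHypothesis.ValiantsHypothesis.Theorems.SymPencilPerFourOneRowPoint
import Summits.ValiantsHypothesis.ValiantsHypothesis.Theorems.SymPencilPerFourOneRowCells
import Summits.ValiantsHypothesis.ValiantsHypothesis.Theorems.SymPencilSdcPerFourTwentySeven
import Summits.ValiantsHypothesis.ValiantsHypothesis.Theorems.SymPencilPerFourBlocksThree
import Summits.ValiantsHypothesis.ValiantsHypothesis.Theorems.SymPencilLagrangianInvariant
import Mathlib.Algebra.Module.Submodule.Union

/-!
# Route `SymPencil` — cell `(13, 3, 0)` of the size-`27` kernel-package table: the kernel is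
# TORIC (three matrix units of one line) or the cell is empty (`--supports`
# stmt-ValiantsHypothesis-5674 `SdcSuperquadratic`; rung currency only — nothing here bears on
# `VP ≠ VNP`)

In the base-point package of a symmetric affine determinantal representation of `per_4` of size
`m ≤ 27` over a field of characteristic `0`
(`SymPencilPerFourBasePointPackage.basepoint_package_of_isSymm_isAffineDetRepr_perPoly_four`),
suppose the space of kernel rows `im bL` is `13`-dimensional (cell `(r, dim V, d) = (13, 3, 0)`;
then `|ι'| = 26 = 2 · 13`, Lagrangian).  The empty family of squares
(`SymPencilIsotropicKernelSquaresBilinear.sum_sq_of_isotropic_defect_bilinear` with `d = 0`) makes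
all `2 × 2` subpermanents vanish on `V = ker bL` (`SymPencilPerFourHessianBlocks`), so `V` is a
hyperplane `H` of one row or one column (`SymPencilPerFourBlocksThree.row_or_col_of_perm_two_blocks_three`).

**Theorem** (`toric_of_rank_thirteen_le_twentySeven`): `H` is a COORDINATE hyperplane — `V` is
spanned by three matrix units `E_{l,k}` (`k ≠ j`) of a row `l`, or by three matrix units of a
column.  Indeed, if `H` is not coordinate it contains a row `w` with all `w_j ≠ 0`
(`Module.Dual.exists_forall_ne_zero_of_forall_exists`), the Lagrangian invariance
(`SymPencilLagrangianInvariant.mulVec_mem_range_of_lagrangian`) holds at `embV w`, `im bL` is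
spanned by the other rows and one vector `bL (embV w₀)` (`w₀ ∉ H`), and
`SymPencilPerFourOneRowPoint.false_of_oneRow_point` is a contradiction (`toric_of_line`,
`toric_of_row`, `toric_of_col`).

Honest framing: this REDUCES the cell `(13, 3, 0)` to its toric sub-case (three matrix units of a
line), which stays OPEN here; the cells `(8,8,10)`, `(9,7,8)`, `(11,5,4)`, `(12,4,2)` are untouched;
the window `27 ≤ sdc(per₄) ≤ 29` is UNCHANGED; stmt-5674 `SdcSuperquadratic` stays OPEN;
`VP ≠ VNP` is not moved; no summit statement is proved here.  No definitions, no named facts.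
[folklore]
-/

noncomputable section

-- single-conjunct layout: Sub = Summit, duplicated namespace component intended
set_option linter.dupNamespace false

namespace Summit.ValiantsHypothesis.ValiantsHypothesis.Theorems.SymPencilSdcPerFourCellThirteenThree

open Matrix MvPolynomial Module
open Literature.Computability.AlgebraicComplexity
open Summit.ValiantsHypothesis.ValiantsHypothesis.Theorems.SymPencilPerFourOneRowCells
open Summit.ValiantsHypothesis.ValiantsHypothesis.Theorems.SymPencilPerFourOneRowPoint
open Summit.ValiantsHypothesis.ValiantsHypothesis.Theorems.SymPencilLagrangianInvariant
open Summit.ValiantsHypothesis.ValiantsHypothesis.Theorems.SymPencilIsotropicKernelSquaresBilinear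
open Summit.ValiantsHypothesis.ValiantsHypothesis.Theorems.SymPencilPerFourHessianBlocks
open Summit.ValiantsHypothesis.ValiantsHypothesis.Theorems.SymPencilPerFourBlocksThree

universe u

variable {K : Type u} [Field K] [CharZero K] {ι' : Type*} [Fintype ι'] [DecidableEq ι']

/-! ### The abstract line lemma -/

/-- **A `3`-dimensional kernel inside one line is toric.**  DATA: the kernel package (Lagrangian:
`|ι'| = 2 · rk bL`), `dim ker bL = 3`, a line embedding `embV` (left inverse `ρ`), the
complementary embedding `embX` with `z = embV (ρ z) + embX (ξ z)`, `ker bL ⊆ im embV`, and the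
permanent identity `per_4 (embV w + s · embX x) = s³ per [w; x]`.  CONCLUSION: for some
coordinate `j`, `bL x = 0 ↔ x = embV (ρ x) ∧ (ρ x) j = 0`.  See the module docstring. [folklore] -/
theorem toric_of_line {D : Matrix ι' ι' K} (hD : IsUnit D.det) (hDs : Dᵀ = D)
    (bL : (Fin 4 × Fin 4 → K) →ₗ[K] (ι' → K))
    (CL : (Fin 4 × Fin 4 → K) →ₗ[K] Matrix ι' ι' K) (hCs : ∀ z, (CL z)ᵀ = CL z)
    {κ : K} (hκ : κ ≠ 0)
    (hi : ∀ z, bL z ⬝ᵥ D⁻¹ *ᵥ bL z = 0)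
    (hii : ∀ z, bL z ⬝ᵥ (D⁻¹ * CL z * D⁻¹) *ᵥ bL z = 0)
    (hN : ∀ v, bL v = 0 → IsUnit (D + CL v).det ∧ ∀ (z : Fin 4 × Fin 4 → K) (s : K),
      κ * MvPolynomial.eval (v + s • z) (perPoly (Fin 4) K) =
        (Matrix.fromBlocks ((s * 0) • (1 : Matrix Unit Unit K))
          (Matrix.replicateRow Unit (s • bL z)) (Matrix.replicateCol Unit (s • bL z))
          (D + CL v + s • CL z)).det)
    (hL : Fintype.card ι' = 2 * finrank K (LinearMap.range bL))
    (hk3 : finrank K (LinearMap.ker bL) = 3)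
    (embV : (Fin 4 → K) →ₗ[K] (Fin 4 × Fin 4 → K))
    (embX : (Fin 3 → Fin 4 → K) →ₗ[K] (Fin 4 × Fin 4 → K))
    (ρ : (Fin 4 × Fin 4 → K) →ₗ[K] (Fin 4 → K)) (ξ : (Fin 4 × Fin 4 → K) → (Fin 3 → Fin 4 → K))
    (hρV : ∀ w, ρ (embV w) = w) (hdecomp : ∀ z, z = embV (ρ z) + embX (ξ z))
    (hker : ∀ x, bL x = 0 → x = embV (ρ x))
    (hper : ∀ (w : Fin 4 → K) (x : Fin 3 → Fin 4 → K) (s : K),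
      MvPolynomial.eval (embV w + s • embX x) (perPoly (Fin 4) K) =
        s ^ 3 * (Matrix.of ![w, x 0, x 1, x 2]).permanent) :
    ∃ j : Fin 4, ∀ x, bL x = 0 ↔ x = embV (ρ x) ∧ ρ x j = 0 := by
  classical
  set H : Submodule K (Fin 4 → K) := (LinearMap.ker bL).comap embV with hHdef
  have hH : ∀ w, w ∈ H ↔ bL (embV w) = 0 := fun w => by
    rw [hHdef, Submodule.mem_comap, LinearMap.mem_ker]
  have hinjV : Function.Injective embV := fun a b h => by
    have h' := congrArg ρ h
    rwa [hρV, hρV] at h'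
  have hker_le : LinearMap.ker bL ≤ LinearMap.range embV := fun x hx =>
    ⟨ρ x, (hker x (LinearMap.mem_ker.1 hx)).symm⟩
  have hmapH : H.map embV = LinearMap.ker bL := by
    rw [hHdef, Submodule.map_comap_eq, inf_eq_right.2 hker_le]
  have hH3 : finrank K H = 3 := by
    have e := (Submodule.equivMapOfInjective embV hinjV H).finrank_eq
    rw [hmapH, hk3] at e
    exact e
  -- `f = bL ∘ embV`: kernel `H`, range a line
  set f : (Fin 4 → K) →ₗ[K] (ι' → K) := bL ∘ₗ embV with hfdef
  have hf : ∀ w, f w = bL (embV w) := fun w => rfl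
  have hkerf : LinearMap.ker f = H := by
    ext w
    rw [LinearMap.mem_ker, hf, hH]
  have hrf : finrank K (LinearMap.range f) = 1 := by
    have h := LinearMap.finrank_range_add_finrank_ker f
    rw [hkerf, hH3, Module.finrank_fin_fun] at h
    omega
  by_cases hgood : ∀ j : Fin 4, ∃ w ∈ H, w j ≠ 0
  · exfalso
    -- a kernel row with all coordinates non-zero
    obtain ⟨⟨w, hwH⟩, hwj⟩ := Module.Dual.exists_forall_ne_zero_of_forall_exists
      (fun j : Fin 4 => (LinearMap.proj j : (Fin 4 → K) →ₗ[K] K) ∘ₗ H.subtype)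
      (fun j => by
        obtain ⟨w, hw, hwj⟩ := hgood j
        exact ⟨⟨w, hw⟩, hwj⟩)
    have hv : ∀ j, w j ≠ 0 := fun j => hwj j
    have hw : bL (embV w) = 0 := (hH w).1 hwH
    -- a row outside `H`, spanning `im f`
    have hHlt : H < ⊤ := by
      refine lt_top_iff_ne_top.2 fun htop => ?_
      have h := hH3
      rw [htop, finrank_top, Module.finrank_fin_fun] at h
      omega
    obtain ⟨w₀, -, hw₀⟩ := SetLike.exists_of_lt hHlt
    have hn0 : f w₀ ≠ 0 := fun h => hw₀ (by rw [← hkerf, LinearMap.mem_ker]; exact h)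
    have hspan : ∀ r : Fin 4 → K, ∃ c : K, c • f w₀ = f r := by
      intro r
      have hv0 : (⟨f w₀, LinearMap.mem_range_self f w₀⟩ : LinearMap.range f) ≠ 0 := by
        intro h
        apply hn0
        simpa using congrArg Subtype.val h
      obtain ⟨c, hc⟩ := (finrank_eq_one_iff_of_nonzero' _ hv0).1 hrf
        ⟨f r, LinearMap.mem_range_self f r⟩
      exact ⟨c, by simpa using congrArg Subtype.val hc⟩
    have hEXr : ∀ z, ∃ (x : Fin 3 → Fin 4 → K) (c : K),
        bL (embX x) + c • bL (embV w₀) = bL z := by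
      intro z
      obtain ⟨c, hc⟩ := hspan (ρ z)
      refine ⟨ξ z, c, ?_⟩
      rw [hf, hf] at hc
      conv_rhs => rw [hdecomp z]
      rw [map_add, hc, add_comm]
    have hinv : ∀ y ∈ LinearMap.range bL,
        CL (embV w) *ᵥ (D⁻¹ *ᵥ y) ∈ LinearMap.range bL := fun y hy =>
      mulVec_mem_range_of_lagrangian hD hDs bL CL hCs hi hii hL (embV w) hw y hy
    exact false_of_oneRow_point hD hDs bL CL hCs hκ hii hN embV embX w w₀ hw hv hEXr hinv hper
  · -- `H` is a coordinate hyperplane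
    push Not at hgood
    obtain ⟨j, hj⟩ := hgood
    have hle : H ≤ LinearMap.ker (LinearMap.proj j : (Fin 4 → K) →ₗ[K] K) := fun w hw =>
      LinearMap.mem_ker.2 (hj w hw)
    have hkerj : finrank K (LinearMap.ker (LinearMap.proj j : (Fin 4 → K) →ₗ[K] K)) = 3 := by
      have h := LinearMap.finrank_range_add_finrank_ker (LinearMap.proj j : (Fin 4 → K) →ₗ[K] K)
      have hr : LinearMap.range (LinearMap.proj j : (Fin 4 → K) →ₗ[K] K) = ⊤ := by
        rw [LinearMap.range_eq_top]
        intro c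
        exact ⟨Pi.single j c, by simp⟩
      rw [hr, finrank_top, Module.finrank_self, Module.finrank_fin_fun] at h
      omega
    have hHeq : H = LinearMap.ker (LinearMap.proj j : (Fin 4 → K) →ₗ[K] K) :=
      Submodule.eq_of_le_of_finrank_eq hle (by rw [hH3, hkerj])
    refine ⟨j, fun x => ⟨fun hx => ?_, fun hx => ?_⟩⟩
    · have hxe := hker x hx
      have hρH : ρ x ∈ H := (hH _).2 (by rw [← hxe]; exact hx)
      exact ⟨hxe, hj _ hρH⟩
    · obtain ⟨hxe, hxj⟩ := hx
      have hρH : ρ x ∈ H := by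
        rw [hHeq, LinearMap.mem_ker, LinearMap.proj_apply]
        exact hxj
      rw [hxe]
      exact (hH _).1 hρH

/-! ### Rows and columns -/

/-- **A `3`-dimensional kernel inside the ROW `l` is toric** (Lagrangian kernel package):
`bL x = 0 ↔` `x` is supported on row `l` off one fixed column `j`. [folklore] -/
theorem toric_of_row {D : Matrix ι' ι' K} (hD : IsUnit D.det) (hDs : Dᵀ = D)
    (bL : (Fin 4 × Fin 4 → K) →ₗ[K] (ι' → K))
    (CL : (Fin 4 × Fin 4 → K) →ₗ[K] Matrix ι' ι' K) (hCs : ∀ z, (CL z)ᵀ = CL z)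
    {κ : K} (hκ : κ ≠ 0)
    (hi : ∀ z, bL z ⬝ᵥ D⁻¹ *ᵥ bL z = 0)
    (hii : ∀ z, bL z ⬝ᵥ (D⁻¹ * CL z * D⁻¹) *ᵥ bL z = 0)
    (hN : ∀ v, bL v = 0 → IsUnit (D + CL v).det ∧ ∀ (z : Fin 4 × Fin 4 → K) (s : K),
      κ * MvPolynomial.eval (v + s • z) (perPoly (Fin 4) K) =
        (Matrix.fromBlocks ((s * 0) • (1 : Matrix Unit Unit K))
          (Matrix.replicateRow Unit (s • bL z)) (Matrix.replicateCol Unit (s • bL z))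
          (D + CL v + s • CL z)).det)
    (hL : Fintype.card ι' = 2 * finrank K (LinearMap.range bL))
    (hk3 : finrank K (LinearMap.ker bL) = 3)
    (l : Fin 4) (hrow : ∀ x, bL x = 0 → ∀ i j, i ≠ l → x (i, j) = 0) :
    ∃ j : Fin 4, ∀ x, bL x = 0 ↔ (∀ i k : Fin 4, i ≠ l → x (i, k) = 0) ∧ x (l, j) = 0 := by
  classical
  -- the embeddings of the row `l` and of the other rows (as in `SymPencilPerFourOneRowCells`)
  let embV : (Fin 4 → K) →ₗ[K] (Fin 4 × Fin 4 → K) :=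
    { toFun := fun w p => if p.1 = l then w p.2 else 0
      map_add' := fun w w' => by
        funext p; simp only [Pi.add_apply]; split_ifs <;> simp
      map_smul' := fun c w => by
        funext p; simp only [Pi.smul_apply, smul_eq_mul, RingHom.id_apply]; split_ifs <;> simp }
  have hembV : ∀ w p, embV w p = if p.1 = l then w p.2 else 0 := fun _ _ => rfl
  let σ := finSuccAboveEquiv l
  have hσ : ∀ a (h : l.succAbove a ≠ l), σ.symm ⟨l.succAbove a, h⟩ = a := fun a h => by
    rw [Equiv.symm_apply_eq]; exact Subtype.ext (finSuccAboveEquiv_apply l a ▸ rfl)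
  let embX : (Fin 3 → Fin 4 → K) →ₗ[K] (Fin 4 × Fin 4 → K) :=
    { toFun := fun x p => if h : p.1 = l then 0 else x (σ.symm ⟨p.1, h⟩) p.2
      map_add' := fun x x' => by
        funext p; simp only [Pi.add_apply]; split_ifs <;> simp
      map_smul' := fun c x => by
        funext p; simp only [Pi.smul_apply, smul_eq_mul, RingHom.id_apply]; split_ifs <;> simp }
  have hembXl : ∀ x j, embX x (l, j) = 0 := fun x j => by
    show (if h : ((l, j) : Fin 4 × Fin 4).1 = l then (0 : K) else _) = 0
    rw [dif_pos rfl]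
  have hembXa : ∀ x a j, embX x (l.succAbove a, j) = x a j := fun x a j => by
    have hne : l.succAbove a ≠ l := Fin.succAbove_ne l a
    show (if h : ((l.succAbove a, j) : Fin 4 × Fin 4).1 = l then (0 : K) else
      x (σ.symm ⟨(l.succAbove a, j).1, h⟩) (l.succAbove a, j).2) = x a j
    rw [dif_neg hne, hσ a hne]
  let ρ : (Fin 4 × Fin 4 → K) →ₗ[K] (Fin 4 → K) := LinearMap.funLeft K K fun k => (l, k)
  have hρ : ∀ z k, ρ z k = z (l, k) := fun _ _ => rfl
  let ξ : (Fin 4 × Fin 4 → K) → (Fin 3 → Fin 4 → K) := fun z a k => z (l.succAbove a, k)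
  have hρV : ∀ w, ρ (embV w) = w := fun w => by
    funext k
    rw [hρ, hembV, if_pos rfl]
  have hdecomp : ∀ z : Fin 4 × Fin 4 → K, z = embV (ρ z) + embX (ξ z) := by
    intro z
    funext ⟨i, j⟩
    rcases Fin.eq_self_or_eq_succAbove l i with rfl | ⟨a, rfl⟩
    · rw [Pi.add_apply, hembXl, hembV, if_pos rfl, add_zero, hρ]
    · rw [Pi.add_apply, hembXa, hembV, if_neg (Fin.succAbove_ne _ a), zero_add]
  have hsupp : ∀ x : Fin 4 × Fin 4 → K,
      x = embV (ρ x) ↔ ∀ i k : Fin 4, i ≠ l → x (i, k) = 0 := by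
    intro x
    constructor
    · intro hx i k hil
      rw [hx, hembV, if_neg hil]
    · intro hx
      funext ⟨i, k⟩
      rw [hembV]
      split_ifs with h
      · simp only at h; rw [h, hρ]
      · exact hx i k h
  have hker : ∀ x, bL x = 0 → x = embV (ρ x) := fun x hx => (hsupp x).2 (hrow x hx)
  have hper : ∀ (w : Fin 4 → K) (x : Fin 3 → Fin 4 → K) (s : K),
      MvPolynomial.eval (embV w + s • embX x) (perPoly (Fin 4) K) =
        s ^ 3 * (Matrix.of ![w, x 0, x 1, x 2]).permanent := by
    intro w x s
    rw [eval_perPoly]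
    refine permanent_of_row_data l _ w x s (fun j => ?_) (fun a j => ?_)
    · rw [Matrix.of_apply, Pi.add_apply, Pi.smul_apply, hembV, if_pos rfl, hembXl, smul_zero,
        add_zero]
    · rw [Matrix.of_apply, Pi.add_apply, Pi.smul_apply, hembV, if_neg (Fin.succAbove_ne l a),
        hembXa, smul_eq_mul, zero_add]
  obtain ⟨j, hj⟩ := toric_of_line hD hDs bL CL hCs hκ hi hii hN hL hk3 embV embX ρ ξ hρV hdecomp
    hker hper
  refine ⟨j, fun x => ?_⟩
  rw [hj x, hsupp x, hρ]

/-- **A `3`-dimensional kernel inside the COLUMN `c` is toric** (Lagrangian kernel package):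
`bL x = 0 ↔` `x` is supported on column `c` off one fixed row `i`. [folklore] -/
theorem toric_of_col {D : Matrix ι' ι' K} (hD : IsUnit D.det) (hDs : Dᵀ = D)
    (bL : (Fin 4 × Fin 4 → K) →ₗ[K] (ι' → K))
    (CL : (Fin 4 × Fin 4 → K) →ₗ[K] Matrix ι' ι' K) (hCs : ∀ z, (CL z)ᵀ = CL z)
    {κ : K} (hκ : κ ≠ 0)
    (hi : ∀ z, bL z ⬝ᵥ D⁻¹ *ᵥ bL z = 0)
    (hii : ∀ z, bL z ⬝ᵥ (D⁻¹ * CL z * D⁻¹) *ᵥ bL z = 0)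
    (hN : ∀ v, bL v = 0 → IsUnit (D + CL v).det ∧ ∀ (z : Fin 4 × Fin 4 → K) (s : K),
      κ * MvPolynomial.eval (v + s • z) (perPoly (Fin 4) K) =
        (Matrix.fromBlocks ((s * 0) • (1 : Matrix Unit Unit K))
          (Matrix.replicateRow Unit (s • bL z)) (Matrix.replicateCol Unit (s • bL z))
          (D + CL v + s • CL z)).det)
    (hL : Fintype.card ι' = 2 * finrank K (LinearMap.range bL))
    (hk3 : finrank K (LinearMap.ker bL) = 3)
    (c : Fin 4) (hcol : ∀ x, bL x = 0 → ∀ i j, j ≠ c → x (i, j) = 0) :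
    ∃ i : Fin 4, ∀ x, bL x = 0 ↔ (∀ k j : Fin 4, j ≠ c → x (k, j) = 0) ∧ x (i, c) = 0 := by
  classical
  let embV : (Fin 4 → K) →ₗ[K] (Fin 4 × Fin 4 → K) :=
    { toFun := fun w p => if p.2 = c then w p.1 else 0
      map_add' := fun w w' => by
        funext p; simp only [Pi.add_apply]; split_ifs <;> simp
      map_smul' := fun c w => by
        funext p; simp only [Pi.smul_apply, smul_eq_mul, RingHom.id_apply]; split_ifs <;> simp }
  have hembV : ∀ w p, embV w p = if p.2 = c then w p.1 else 0 := fun _ _ => rfl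
  let σ := finSuccAboveEquiv c
  have hσ : ∀ a (h : c.succAbove a ≠ c), σ.symm ⟨c.succAbove a, h⟩ = a := fun a h => by
    rw [Equiv.symm_apply_eq]; exact Subtype.ext (finSuccAboveEquiv_apply c a ▸ rfl)
  let embX : (Fin 3 → Fin 4 → K) →ₗ[K] (Fin 4 × Fin 4 → K) :=
    { toFun := fun x p => if h : p.2 = c then 0 else x (σ.symm ⟨p.2, h⟩) p.1
      map_add' := fun x x' => by
        funext p; simp only [Pi.add_apply]; split_ifs <;> simp
      map_smul' := fun c x => by
        funext p; simp only [Pi.smul_apply, smul_eq_mul, RingHom.id_apply]; split_ifs <;> simp }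
  have hembXc : ∀ x i, embX x (i, c) = 0 := fun x i => by
    show (if h : ((i, c) : Fin 4 × Fin 4).2 = c then (0 : K) else _) = 0
    rw [dif_pos rfl]
  have hembXa : ∀ x a i, embX x (i, c.succAbove a) = x a i := fun x a i => by
    have hne : c.succAbove a ≠ c := Fin.succAbove_ne c a
    show (if h : ((i, c.succAbove a) : Fin 4 × Fin 4).2 = c then (0 : K) else
      x (σ.symm ⟨(i, c.succAbove a).2, h⟩) (i, c.succAbove a).1) = x a i
    rw [dif_neg hne, hσ a hne]
  let ρ : (Fin 4 × Fin 4 → K) →ₗ[K] (Fin 4 → K) := LinearMap.funLeft K K fun k => (k, c)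
  have hρ : ∀ z k, ρ z k = z (k, c) := fun _ _ => rfl
  let ξ : (Fin 4 × Fin 4 → K) → (Fin 3 → Fin 4 → K) := fun z a i => z (i, c.succAbove a)
  have hρV : ∀ w, ρ (embV w) = w := fun w => by
    funext k
    rw [hρ, hembV, if_pos rfl]
  have hdecomp : ∀ z : Fin 4 × Fin 4 → K, z = embV (ρ z) + embX (ξ z) := by
    intro z
    funext ⟨i, j⟩
    rcases Fin.eq_self_or_eq_succAbove c j with rfl | ⟨a, rfl⟩
    · rw [Pi.add_apply, hembXc, hembV, if_pos rfl, add_zero, hρ]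
    · rw [Pi.add_apply, hembXa, hembV, if_neg (Fin.succAbove_ne _ a), zero_add]
  have hsupp : ∀ x : Fin 4 × Fin 4 → K,
      x = embV (ρ x) ↔ ∀ k j : Fin 4, j ≠ c → x (k, j) = 0 := by
    intro x
    constructor
    · intro hx k j hjc
      rw [hx, hembV, if_neg hjc]
    · intro hx
      funext ⟨k, j⟩
      rw [hembV]
      split_ifs with h
      · simp only at h; rw [h, hρ]
      · exact hx k j h
  have hker : ∀ x, bL x = 0 → x = embV (ρ x) := fun x hx => (hsupp x).2 (hcol x hx)
  have hper : ∀ (w : Fin 4 → K) (x : Fin 3 → Fin 4 → K) (s : K),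
      MvPolynomial.eval (embV w + s • embX x) (perPoly (Fin 4) K) =
        s ^ 3 * (Matrix.of ![w, x 0, x 1, x 2]).permanent := by
    intro w x s
    rw [eval_perPoly]
    refine permanent_of_col_data c _ w x s (fun i => ?_) (fun a i => ?_)
    · rw [Matrix.of_apply, Pi.add_apply, Pi.smul_apply, hembV, if_pos rfl, hembXc, smul_zero,
        add_zero]
    · rw [Matrix.of_apply, Pi.add_apply, Pi.smul_apply, hembV, if_neg (Fin.succAbove_ne c a),
        hembXa, smul_eq_mul, zero_add]
  obtain ⟨i, hi'⟩ := toric_of_line hD hDs bL CL hCs hκ hi hii hN hL hk3 embV embX ρ ξ hρV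
    hdecomp hker hper
  refine ⟨i, fun x => ?_⟩
  rw [hi' x, hsupp x, hρ]

/-! ### The cell `(13, 3, 0)` -/

/-- **Cell `(13, 3, 0)` of the size-`27` table is TORIC or empty**: in the base-point package of a
symmetric affine determinantal representation of `per_4` of size `m ≤ 27` (characteristic `0`)
with a `13`-dimensional space of kernel rows, the kernel `ker bL` is spanned by the three matrix
units of one row off one column, or of one column off one row (hypotheses as exported by
`SymPencilPerFourBasePointPackage.basepoint_package_of_isSymm_isAffineDetRepr_perPoly_four`).
The toric sub-case itself is NOT excluded here. [folklore] -/
theorem toric_of_rank_thirteen_le_twentySeven (K : Type*) [Field K] [CharZero K]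
    {m : ℕ} (hm : m ≤ 27)
    {i₀ : Fin m} {D : Matrix {i // i ≠ i₀} {i // i ≠ i₀} K}
    {bL : (Fin 4 × Fin 4 → K) →ₗ[K] ({i // i ≠ i₀} → K)}
    {CL : (Fin 4 × Fin 4 → K) →ₗ[K] Matrix {i // i ≠ i₀} {i // i ≠ i₀} K} {κ : K}
    (hD : IsUnit D.det) (hDs : Dᵀ = D) (hCs : ∀ z, (CL z)ᵀ = CL z) (hκ : κ ≠ 0)
    (hi : ∀ z, bL z ⬝ᵥ D⁻¹ *ᵥ bL z = 0)
    (hii : ∀ z, bL z ⬝ᵥ (D⁻¹ * CL z * D⁻¹) *ᵥ bL z = 0)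
    (hiii : ∀ z, D.det * (bL z ⬝ᵥ (D⁻¹ * CL z * D⁻¹ * CL z * D⁻¹) *ᵥ bL z) =
      -(κ * eval z (perPoly (Fin 4) K)))
    (hcard : Fintype.card {i // i ≠ i₀} + 1 = m)
    (hranle : 2 * finrank K (LinearMap.range bL) ≤ Fintype.card {i // i ≠ i₀})
    (hrn : finrank K (LinearMap.range bL) + finrank K (LinearMap.ker bL) = 16)
    (hN : ∀ v, bL v = 0 → IsUnit (D + CL v).det ∧ ∀ (z : Fin 4 × Fin 4 → K) (s : K),
      κ * eval (v + s • z) (perPoly (Fin 4) K) =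
        (Matrix.fromBlocks ((s * 0) • (1 : Matrix Unit Unit K))
          (Matrix.replicateRow Unit (s • bL z)) (Matrix.replicateCol Unit (s • bL z))
          (D + CL v + s • CL z)).det)
    (h13 : finrank K (LinearMap.range bL) = 13) :
    (∃ l j : Fin 4, ∀ x, bL x = 0 ↔ (∀ i k : Fin 4, i ≠ l → x (i, k) = 0) ∧ x (l, j) = 0) ∨
    (∃ c i : Fin 4, ∀ x, bL x = 0 ↔ (∀ k j : Fin 4, j ≠ c → x (k, j) = 0) ∧ x (i, c) = 0) := by
  classical
  have hk3 : finrank K (LinearMap.ker bL) = 3 := by omega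
  have hL : Fintype.card {i // i ≠ i₀} = 2 * finrank K (LinearMap.range bL) := by omega
  -- NO squares along the kernel, so all `2 × 2` subpermanents vanish there
  obtain ⟨c, β, hcβ⟩ := sum_sq_of_isotropic_defect_bilinear hD hDs bL CL hCs
    (fun z => eval z (perPoly (Fin 4) K)) hκ hi hii hiii 0 (by omega)
  have hB : ∀ y ∈ LinearMap.ker bL, ∀ i k j l : Fin 4, i ≠ k → j ≠ l →
      y (i, j) * y (k, l) + y (i, l) * y (k, j) = 0 := fun y hy =>
    perm_two_blocks_of_sum_sq_swap (ι := Fin 0) (by simp) y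
      ⟨c, fun k => (β k).flip y, fun u => by
        obtain ⟨e₀, e₁, he⟩ := hcβ u y (LinearMap.mem_ker.1 hy)
        exact ⟨e₀, e₁, fun s => by simpa only [LinearMap.flip_apply] using he s⟩⟩
  rcases row_or_col_of_perm_two_blocks_three (LinearMap.ker bL) hB hk3 with ⟨l, hl⟩ | ⟨c', hc'⟩
  · left
    obtain ⟨j, hj⟩ := toric_of_row hD hDs bL CL hCs hκ hi hii hN hL hk3 l
      fun x hx => hl x (LinearMap.mem_ker.2 hx)
    exact ⟨l, j, hj⟩
  · right
    obtain ⟨i, hi'⟩ := toric_of_col hD hDs bL CL hCs hκ hi hii hN hL hk3 c'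
      fun x hx => hc' x (LinearMap.mem_ker.2 hx)
    exact ⟨c', i, hi'⟩

end Summit.ValiantsHypothesis.ValiantsHypothesis.Theorems.SymPencilSdcPerFourCellThirteenThree

end
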